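import Literature.InformationTheory.QuantumCodes.LinearProgrammingBoundAdditive
import Summits.Ventures.QEC.Census.RainsLPBounds.K0Pure
import HarnessLib

/-!
# No `[[n,0,d_LP+1]]` self-dual additive code: the `k = 0` column of CRSS Table III as kernel theorems

Venture QEC (cell `qec`), item 06.LPK follow-through, rung X1. For every `3 ≤ n ≤ 30` the theorem
`noCode_n_0 : ¬ AdditiveCodeExists n 0 (d_gen + 1)` — NO `[[n,0,d_gen+1]]` ADDITIVE CODE (stabilizer state, CRSS's
pure-by-convention `k = 0` column) EXISTS, unconditionally: the kernel certificate
`rlp_n_0 : ¬ RainsLPFeasiblePure n 1 (d_gen+1)` (`RainsLPBounds/K0Pure.lean`; for `n = 6` the worked instance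
`not_rainsLPFeasiblePure_6_1_5` of `RainsLPCertificate.lean`) composed with the PROVED bridge
`Literature.InformationTheory.QuantumCodes.not_additiveCodeExists_zero_of_not_rainsLPFeasiblePure` (a self-dual
additive code satisfies Rains's pure system with `K = 1`: MacWilliams (CRSS Thm. 5) + purity + the additive shadow,
`LinearProgrammingBoundAdditive.lean`). `d_gen = d_T` (printed upper bound) for 25 cells; `d_gen = d_T + 1` at print's
`β` cells `(7,0)`, `(13,0)`, `(25,0)` (CRSS §7 special arguments). With `Census/LPBounds/NoCode….lean` (434 cells,
`k ≥ 1`) ALL 462 cells of CRSS Table III now carry a kernel nonexistence theorem (453 at print + 1, the nine `β` cells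
at print + 2). Tier KERNEL, axioms standard, no named-fact hypothesis. HONEST FRAMING: nonexistence only; no distance
of any code is certified here. [cite: CalderbankEtAl1998, §8 Table III (k = 0 column) with its notes; Rains1999Shadow, Thm. 10 (Remark)]
-/

namespace Summit.Ventures.QEC.Census.NoCode

open Summit.Ventures.QEC.Census Literature.InformationTheory.QuantumCodes

/-- **No `[[3,0,3]]` additive code** (print: `d ≤ 2` (LP)). (proved, KERNEL, unconditional) [cite: CalderbankEtAl1998, §8 Table III entry (n,k) = (3,0) (printed pp. 32–34)] -/
theorem noCode_3_0 : ¬ AdditiveCodeExists 3 0 3 :=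
  not_additiveCodeExists_zero_of_not_rainsLPFeasiblePure RainsLPData.rlp_3_0

/-- **No `[[4,0,3]]` additive code** (print: `d ≤ 2` (LP)). (proved, KERNEL, unconditional) [cite: CalderbankEtAl1998, §8 Table III entry (n,k) = (4,0) (printed pp. 32–34)] -/
theorem noCode_4_0 : ¬ AdditiveCodeExists 4 0 3 :=
  not_additiveCodeExists_zero_of_not_rainsLPFeasiblePure RainsLPData.rlp_4_0

/-- **No `[[5,0,4]]` additive code** (print: `d ≤ 3` (LP)). (proved, KERNEL, unconditional) [cite: CalderbankEtAl1998, §8 Table III entry (n,k) = (5,0) (printed pp. 32–34)] -/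
theorem noCode_5_0 : ¬ AdditiveCodeExists 5 0 4 :=
  not_additiveCodeExists_zero_of_not_rainsLPFeasiblePure RainsLPData.rlp_5_0

/-- **No `[[6,0,5]]` additive code** (print: `d ≤ 4` (LP)). (proved, KERNEL, unconditional) [cite: CalderbankEtAl1998, §8 Table III entry (n,k) = (6,0) (printed pp. 32–34)] -/
theorem noCode_6_0 : ¬ AdditiveCodeExists 6 0 5 :=
  not_additiveCodeExists_zero_of_not_rainsLPFeasiblePure not_rainsLPFeasiblePure_6_1_5

/-- **No `[[7,0,5]]` additive code** (print's `β` cell: `d ≤ 3` by a special argument; LP optimum `4`). (proved, KERNEL, unconditional) [cite: CalderbankEtAl1998, §8 Table III entry (n,k) = (7,0) (printed pp. 32–34)] -/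
theorem noCode_7_0 : ¬ AdditiveCodeExists 7 0 5 :=
  not_additiveCodeExists_zero_of_not_rainsLPFeasiblePure RainsLPData.rlp_7_0

/-- **No `[[8,0,5]]` additive code** (print: `d ≤ 4` (LP)). (proved, KERNEL, unconditional) [cite: CalderbankEtAl1998, §8 Table III entry (n,k) = (8,0) (printed pp. 32–34)] -/
theorem noCode_8_0 : ¬ AdditiveCodeExists 8 0 5 :=
  not_additiveCodeExists_zero_of_not_rainsLPFeasiblePure RainsLPData.rlp_8_0

/-- **No `[[9,0,5]]` additive code** (print: `d ≤ 4` (LP)). (proved, KERNEL, unconditional) [cite: CalderbankEtAl1998, §8 Table III entry (n,k) = (9,0) (printed pp. 32–34)] -/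
theorem noCode_9_0 : ¬ AdditiveCodeExists 9 0 5 :=
  not_additiveCodeExists_zero_of_not_rainsLPFeasiblePure RainsLPData.rlp_9_0

/-- **No `[[10,0,5]]` additive code** (print: `d ≤ 4` (LP)). (proved, KERNEL, unconditional) [cite: CalderbankEtAl1998, §8 Table III entry (n,k) = (10,0) (printed pp. 32–34)] -/
theorem noCode_10_0 : ¬ AdditiveCodeExists 10 0 5 :=
  not_additiveCodeExists_zero_of_not_rainsLPFeasiblePure RainsLPData.rlp_10_0

/-- **No `[[11,0,6]]` additive code** (print: `d ≤ 5` (LP)). (proved, KERNEL, unconditional) [cite: CalderbankEtAl1998, §8 Table III entry (n,k) = (11,0) (printed pp. 32–34)] -/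
theorem noCode_11_0 : ¬ AdditiveCodeExists 11 0 6 :=
  not_additiveCodeExists_zero_of_not_rainsLPFeasiblePure RainsLPData.rlp_11_0

/-- **No `[[12,0,7]]` additive code** (print: `d ≤ 6` (LP)). (proved, KERNEL, unconditional) [cite: CalderbankEtAl1998, §8 Table III entry (n,k) = (12,0) (printed pp. 32–34)] -/
theorem noCode_12_0 : ¬ AdditiveCodeExists 12 0 7 :=
  not_additiveCodeExists_zero_of_not_rainsLPFeasiblePure RainsLPData.rlp_12_0

/-- **No `[[13,0,7]]` additive code** (print's `β` cell: `d ≤ 5` by a special argument; LP optimum `6`). (proved, KERNEL, unconditional) [cite: CalderbankEtAl1998, §8 Table III entry (n,k) = (13,0) (printed pp. 32–34)] -/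
theorem noCode_13_0 : ¬ AdditiveCodeExists 13 0 7 :=
  not_additiveCodeExists_zero_of_not_rainsLPFeasiblePure RainsLPData.rlp_13_0

/-- **No `[[14,0,7]]` additive code** (print: `d ≤ 6` (LP)). (proved, KERNEL, unconditional) [cite: CalderbankEtAl1998, §8 Table III entry (n,k) = (14,0) (printed pp. 32–34)] -/
theorem noCode_14_0 : ¬ AdditiveCodeExists 14 0 7 :=
  not_additiveCodeExists_zero_of_not_rainsLPFeasiblePure RainsLPData.rlp_14_0

/-- **No `[[15,0,7]]` additive code** (print: `d ≤ 6` (LP)). (proved, KERNEL, unconditional) [cite: CalderbankEtAl1998, §8 Table III entry (n,k) = (15,0) (printed pp. 32–34)] -/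
theorem noCode_15_0 : ¬ AdditiveCodeExists 15 0 7 :=
  not_additiveCodeExists_zero_of_not_rainsLPFeasiblePure RainsLPData.rlp_15_0

/-- **No `[[16,0,7]]` additive code** (print: `d ≤ 6` (LP)). (proved, KERNEL, unconditional) [cite: CalderbankEtAl1998, §8 Table III entry (n,k) = (16,0) (printed pp. 32–34)] -/
theorem noCode_16_0 : ¬ AdditiveCodeExists 16 0 7 :=
  not_additiveCodeExists_zero_of_not_rainsLPFeasiblePure RainsLPData.rlp_16_0

/-- **No `[[17,0,8]]` additive code** (print: `d ≤ 7` (LP)). (proved, KERNEL, unconditional) [cite: CalderbankEtAl1998, §8 Table III entry (n,k) = (17,0) (printed pp. 32–34)] -/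
theorem noCode_17_0 : ¬ AdditiveCodeExists 17 0 8 :=
  not_additiveCodeExists_zero_of_not_rainsLPFeasiblePure RainsLPData.rlp_17_0

/-- **No `[[18,0,9]]` additive code** (print: `d ≤ 8` (LP)). (proved, KERNEL, unconditional) [cite: CalderbankEtAl1998, §8 Table III entry (n,k) = (18,0) (printed pp. 32–34)] -/
theorem noCode_18_0 : ¬ AdditiveCodeExists 18 0 9 :=
  not_additiveCodeExists_zero_of_not_rainsLPFeasiblePure RainsLPData.rlp_18_0

/-- **No `[[19,0,9]]` additive code** (print: `d ≤ 8` (LP)). (proved, KERNEL, unconditional) [cite: CalderbankEtAl1998, §8 Table III entry (n,k) = (19,0) (printed pp. 32–34)] -/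
theorem noCode_19_0 : ¬ AdditiveCodeExists 19 0 9 :=
  not_additiveCodeExists_zero_of_not_rainsLPFeasiblePure RainsLPData.rlp_19_0

/-- **No `[[20,0,9]]` additive code** (print: `d ≤ 8` (LP)). (proved, KERNEL, unconditional) [cite: CalderbankEtAl1998, §8 Table III entry (n,k) = (20,0) (printed pp. 32–34)] -/
theorem noCode_20_0 : ¬ AdditiveCodeExists 20 0 9 :=
  not_additiveCodeExists_zero_of_not_rainsLPFeasiblePure RainsLPData.rlp_20_0

/-- **No `[[21,0,9]]` additive code** (print: `d ≤ 8` (LP)). (proved, KERNEL, unconditional) [cite: CalderbankEtAl1998, §8 Table III entry (n,k) = (21,0) (printed pp. 32–34)] -/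
theorem noCode_21_0 : ¬ AdditiveCodeExists 21 0 9 :=
  not_additiveCodeExists_zero_of_not_rainsLPFeasiblePure RainsLPData.rlp_21_0

/-- **No `[[22,0,9]]` additive code** (print: `d ≤ 8` (LP)). (proved, KERNEL, unconditional) [cite: CalderbankEtAl1998, §8 Table III entry (n,k) = (22,0) (printed pp. 32–34)] -/
theorem noCode_22_0 : ¬ AdditiveCodeExists 22 0 9 :=
  not_additiveCodeExists_zero_of_not_rainsLPFeasiblePure RainsLPData.rlp_22_0

/-- **No `[[23,0,10]]` additive code** (print: `d ≤ 9` (LP)). (proved, KERNEL, unconditional) [cite: CalderbankEtAl1998, §8 Table III entry (n,k) = (23,0) (printed pp. 32–34)] -/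
theorem noCode_23_0 : ¬ AdditiveCodeExists 23 0 10 :=
  not_additiveCodeExists_zero_of_not_rainsLPFeasiblePure RainsLPData.rlp_23_0

/-- **No `[[24,0,11]]` additive code** (print: `d ≤ 10` (LP)). (proved, KERNEL, unconditional) [cite: CalderbankEtAl1998, §8 Table III entry (n,k) = (24,0) (printed pp. 32–34)] -/
theorem noCode_24_0 : ¬ AdditiveCodeExists 24 0 11 :=
  not_additiveCodeExists_zero_of_not_rainsLPFeasiblePure RainsLPData.rlp_24_0

/-- **No `[[25,0,11]]` additive code** (print's `β` cell: `d ≤ 9` by a special argument; LP optimum `10`). (proved, KERNEL, unconditional) [cite: CalderbankEtAl1998, §8 Table III entry (n,k) = (25,0) (printed pp. 32–34)] -/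
theorem noCode_25_0 : ¬ AdditiveCodeExists 25 0 11 :=
  not_additiveCodeExists_zero_of_not_rainsLPFeasiblePure RainsLPData.rlp_25_0

/-- **No `[[26,0,11]]` additive code** (print: `d ≤ 10` (LP)). (proved, KERNEL, unconditional) [cite: CalderbankEtAl1998, §8 Table III entry (n,k) = (26,0) (printed pp. 32–34)] -/
theorem noCode_26_0 : ¬ AdditiveCodeExists 26 0 11 :=
  not_additiveCodeExists_zero_of_not_rainsLPFeasiblePure RainsLPData.rlp_26_0

/-- **No `[[27,0,11]]` additive code** (print: `d ≤ 10` (LP)). (proved, KERNEL, unconditional) [cite: CalderbankEtAl1998, §8 Table III entry (n,k) = (27,0) (printed pp. 32–34)] -/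
theorem noCode_27_0 : ¬ AdditiveCodeExists 27 0 11 :=
  not_additiveCodeExists_zero_of_not_rainsLPFeasiblePure RainsLPData.rlp_27_0

/-- **No `[[28,0,11]]` additive code** (print: `d ≤ 10` (LP)). (proved, KERNEL, unconditional) [cite: CalderbankEtAl1998, §8 Table III entry (n,k) = (28,0) (printed pp. 32–34)] -/
theorem noCode_28_0 : ¬ AdditiveCodeExists 28 0 11 :=
  not_additiveCodeExists_zero_of_not_rainsLPFeasiblePure RainsLPData.rlp_28_0

/-- **No `[[29,0,12]]` additive code** (print: `d ≤ 11` (LP)). (proved, KERNEL, unconditional) [cite: CalderbankEtAl1998, §8 Table III entry (n,k) = (29,0) (printed pp. 32–34)] -/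
theorem noCode_29_0 : ¬ AdditiveCodeExists 29 0 12 :=
  not_additiveCodeExists_zero_of_not_rainsLPFeasiblePure RainsLPData.rlp_29_0

/-- **No `[[30,0,13]]` additive code** (print: `d ≤ 12` (LP)). (proved, KERNEL, unconditional) [cite: CalderbankEtAl1998, §8 Table III entry (n,k) = (30,0) (printed pp. 32–34)] -/
theorem noCode_30_0 : ¬ AdditiveCodeExists 30 0 13 :=
  not_additiveCodeExists_zero_of_not_rainsLPFeasiblePure RainsLPData.rlp_30_0

end Summit.Ventures.QEC.Census.NoCode
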